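import Summits.KontsevichZagierPeriods.KontsevichZagierPeriods.Theses.CompiledSubstitutions

/-!
# Route CompiledSubstitutions — support item `CompiledSectorGlue`

Closes item stmt-KontsevichZagierPeriods-14367 of route
`route-KontsevichZagierPeriods-CompiledSubstitutions`: the glue
`LegendreSector → ZhouWanKPrimeCubed → ZetaEvenBKC → EulerReflectionRational →
CompiledSectorKernel → AlgebraicFormTarget`.

Pure logic: instantiate `CompiledSectorKernel` at the subgroup `S := KZ.relations` (with
`le_rfl`); its four realisability hypotheses are then the four cruxes verbatim, because
`KZ.Equivalent r r'` unfolds by definition to `KZ.of r - KZ.of r' ∈ KZ.relations`, and its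
conclusion is `AlgebraicFormTarget` verbatim.
-/

-- single-conjunct summit: Sub = Summit, so the namespace segment repeats by design (CONVENTIONS §2)
set_option linter.dupNamespace false

namespace Summit.KontsevichZagierPeriods.KontsevichZagierPeriods.Theorems

open Summit.KontsevichZagierPeriods.KontsevichZagierPeriods.Theses.CompiledSubstitutions

/-- The glue of route CompiledSubstitutions (item stmt-KontsevichZagierPeriods-14367): the four
compiled families (cruxes `LegendreSector`, `ZhouWanKPrimeCubed`, `ZetaEvenBKC`,
`EulerReflectionRational`) together with the kernel conjecture relative to the compiled sector
(`CompiledSectorKernel`) give the target `AlgebraicFormTarget`, by specialising the kernel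
hypothesis to the subgroup of KZ relations itself. -/
theorem compiledSectorGlue_proof : CompiledSectorGlue := by
  unfold CompiledSectorGlue
  intro hL hZ hE hR hK n m r r' hv
  exact hK _ le_rfl hL hZ hE hR r r' hv

end Summit.KontsevichZagierPeriods.KontsevichZagierPeriods.Theorems
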